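import Mathlib
import HarnessLib
import Literature.Analysis.FluidPDE.HardSphereDynamics
import Literature.Analysis.FluidPDE.HardSphereCollisionRecord
import Literature.Analysis.FluidPDE.HardSphereFreeStretch
import Literature.MathematicalPhysics.KineticTheory.CollisionTubePullbackFlight
import Literature.MathematicalPhysics.KineticTheory.HardSphereEuler
import Summits.AtomisticToContinuum.HydrodynamicLimit.Theses.RelayRaceLocality

/-!
# The ghost-needle inclusion: an untouched sphere flies free, so a survival event is a void
# event for its ghost (`RelayRaceLocality.GibbsLightCone`, stmt-AtomisticToContinuum-12501, helper `--supports`)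

Deterministic entry point of the crux idea cards `ghost-needle-peeling` (r2 ideator 6) and
`ghost-tracer-void` (r2 ideator 5), typed as `IdeatorSix.SurvivalSubsetGhostVoid` in
`Cruxes/GibbsLightCone/IdeatorSixSketch.lean`: along a good orbit of a hard-sphere flow on `𝕋³`,
if sphere `p` is in contact with nobody during `[t₀, t₀ + τ]`, then (i) it moves by free flight
there — across the collisions of the OTHER spheres, at which it does not jump
(`Literature…CollisionTubePullbackFlight.apply_eq_translate_of_forall_not_participates`) — and hence
(ii) every other sphere stays at minimal-image distance `> ε` from the FREE continuation of `p`'s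
state at `t₀` (the "ghost needle"): `≥ ε` because the orbit lives in the hard-sphere domain, `≠ ε`
because that would be a contact of `p`. This is the inclusion "survival ⊆ ghost void" used for upper
bounds on hot-flight survival; the converse direction (the others then follow the `p`-erased
dynamics) is the removal/uniqueness lemma `EnskogCompensator.comp_eq_of_closed` of a sibling crux and
is not needed here.

Everything is stated for a general diameter `ε` and particle number `N + 1` (the sheet's typing);
the last theorem is the sheet statement `SurvivalSubsetGhostVoid` verbatim, so a later line importing
this file discharges it by name.
-/

namespace Summit.AtomisticToContinuum.HydrodynamicLimit.Theorems.GhostNeedlePeeling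

open Literature.Analysis.FluidPDE Literature.MathematicalPhysics.KineticTheory Set

variable {ε : ℝ} {N : ℕ}

/-- On the torus, contact is symmetric in the pair: `z ∈ contactSet j p ↔ z ∈ contactSet p j`
(the minimal-image distance is symmetric). [folklore] -/
theorem mem_contactSet_comm_torus (z : Config (N + 1) (Fin 3) T3) (p j : Fin (N + 1)) :
    z ∈ contactSet (Torus.geometry (Fin 3)) (N + 1) ε j p ↔
      z ∈ contactSet (Torus.geometry (Fin 3)) (N + 1) ε p j := by
  simp only [mem_contactSet, Torus.norm_geometry_sepVec, Torus.euclidDist_comm (z j).1 (z p).1]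

/-- A sphere in contact with nobody (in the order `(p, j)`) does not participate in any collision
(torus: contact is symmetric). [folklore] -/
theorem not_participates_of_forall_not_mem_contactSet {z : Config (N + 1) (Fin 3) T3} {p : Fin (N + 1)}
    (hp : ∀ j : Fin (N + 1), j ≠ p → z ∉ contactSet (Torus.geometry (Fin 3)) (N + 1) ε p j) :
    ¬ Participates (Torus.geometry (Fin 3)) ε z p := by
  rintro ⟨j, hpj | hjp⟩
  · obtain ⟨hne, hc⟩ := mem_contactPairs.1 hpj
    exact hp j (fun h => hne h.symm) hc
  · obtain ⟨hne, hc⟩ := mem_contactPairs.1 hjp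
    exact hp j hne ((mem_contactSet_comm_torus z p j).1 hc)

/-- **An untouched sphere flies free.** Along a good orbit, if `p` is in contact with nobody during
`(t₀, u]`, then its state at `u` is the free flight of its state at `t₀`:
`Φ_u z p = (freeFlight (u - t₀) (Φ_{t₀} z)) p`. [folklore] -/
theorem flow_apply_eq_freeFlight_of_forall_not_mem_contactSet
    (Φ : HardSphereFlow (Torus.geometry (Fin 3)) ε (N + 1)) (p : Fin (N + 1)) {t₀ u : ℝ} (hu : t₀ ≤ u)
    {z : Config (N + 1) (Fin 3) T3} (hz : z ∈ Φ.good)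
    (hp : ∀ s ∈ Ioc t₀ u, ∀ j : Fin (N + 1), j ≠ p →
      Φ.flow s z ∉ contactSet (Torus.geometry (Fin 3)) (N + 1) ε p j) :
    Φ.flow u z p = freeFlight (Torus.geometry (Fin 3)) (u - t₀) (Φ.flow t₀ z) p := by
  have h := apply_eq_translate_of_forall_not_participates (γ := fun t => Φ.flow t z)
    (Φ.isTrajectory z hz) Torus.continuous_geometry_translate p hu
    (fun s hs => not_participates_of_forall_not_mem_contactSet (hp s hs))
  simpa only [freeFlight_apply] using h

/-- **Survival ⊆ ghost void, one time.** Along a good orbit, if `p` touches nobody during `(t₀, u]`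
and nobody at time `u` (in particular if it touches nobody on `[t₀, u]`), then at time `u` every other
sphere is at minimal-image distance `> ε` from the ghost of `p` (the free continuation of its state
at `t₀`). [folklore] -/
theorem lt_euclidDist_ghost_of_forall_not_mem_contactSet
    (Φ : HardSphereFlow (Torus.geometry (Fin 3)) ε (N + 1)) (p : Fin (N + 1)) {t₀ u : ℝ} (hu : t₀ ≤ u)
    {z : Config (N + 1) (Fin 3) T3} (hz : z ∈ Φ.good)
    (hp : ∀ s ∈ Ioc t₀ u, ∀ j : Fin (N + 1), j ≠ p →
      Φ.flow s z ∉ contactSet (Torus.geometry (Fin 3)) (N + 1) ε p j)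
    (hpu : ∀ j : Fin (N + 1), j ≠ p → Φ.flow u z ∉ contactSet (Torus.geometry (Fin 3)) (N + 1) ε p j)
    {j : Fin (N + 1)} (hj : j ≠ p) :
    ε < Torus.euclidDist (Φ.flow u z j).1
      (freeFlight (Torus.geometry (Fin 3)) (u - t₀) (Φ.flow t₀ z) p).1 := by
  have hdom : Φ.flow u z ∈ hardSphereDomain (Torus.geometry (Fin 3)) (N + 1) ε :=
    (Φ.isTrajectory z hz).mem u
  have hge : ε ≤ ‖(Torus.geometry (Fin 3)).sepVec (Φ.flow u z j).1 (Φ.flow u z p).1‖ :=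
    mem_hardSphereDomain.1 hdom j p hj
  have hne : ‖(Torus.geometry (Fin 3)).sepVec (Φ.flow u z j).1 (Φ.flow u z p).1‖ ≠ ε := by
    intro hc
    exact hpu j hj ((mem_contactSet_comm_torus (Φ.flow u z) p j).1 (mem_contactSet.2 ⟨hdom, hc⟩))
  rw [← flow_apply_eq_freeFlight_of_forall_not_mem_contactSet Φ p hu hz hp, ← Torus.norm_geometry_sepVec]
  exact lt_of_le_of_ne hge (fun h => hne h.symm)

/-- `IdeatorSix.SurvivalSubsetGhostVoid` (crux-ideate r2 k6, cards `ghost-needle-peeling` /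
`ghost-tracer-void`, the GHOST-NEEDLE IDENTITY in its inclusion form) verbatim: on a good orbit, if
sphere `p` is collision-free on `[t₀, t₀ + τ]`, every other sphere stays at distance `> ε` from the
free continuation of `p`'s state at `t₀` throughout `[t₀, t₀ + τ]`. [folklore] -/
theorem survivalSubsetGhostVoid :
    ∀ (ε : ℝ) (N : ℕ) (Φ : HardSphereFlow (Torus.geometry (Fin 3)) ε (N + 1)) (p : Fin (N + 1))
      (t₀ τ : ℝ), 0 ≤ τ → ∀ z ∈ Φ.good,
      (∀ u ∈ Set.Icc t₀ (t₀ + τ), ∀ j : Fin (N + 1), j ≠ p →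
          Φ.flow u z ∉ contactSet (Torus.geometry (Fin 3)) (N + 1) ε p j) →
      ∀ u ∈ Set.Icc t₀ (t₀ + τ), ∀ j : Fin (N + 1), j ≠ p →
        ε < Torus.euclidDist (Φ.flow u z j).1
          (freeFlight (Torus.geometry (Fin 3)) (u - t₀) (Φ.flow t₀ z) p).1 := by
  intro ε N Φ p t₀ τ _hτ z hz hp u hu j hj
  exact lt_euclidDist_ghost_of_forall_not_mem_contactSet Φ p hu.1 hz
    (fun s hs => hp s ⟨hs.1.le, hs.2.trans hu.2⟩) (hp u hu) hj

end Summit.AtomisticToContinuum.HydrodynamicLimit.Theorems.GhostNeedlePeeling
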